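/-
Copyright (c) 2026 the pub-hodgecm-mathlib formalisation cell (harness21).  Prover seat hodgecm-mathlib-A-p06 (g29) — (U) road, U4-DISCHARGE, FILE 4 «μ^TF_w IS the Cayley chart measure of
the whole source» ((W2)-(n2) input; owner A-p19 (g24) MEMO-U4-NC-v1 §1).
-/
import Literature.NumberTheory.Weil1964.UnitaryArchLocalTopFormHaarWindowAny   -- FILE 3 (A-p06 g29): the local any-window identity (+ FILE 1 null complement, FILE 2 exhaustion)
import HarnessLib

/-!
# `μ^TF_w = ĉ_*(w₀ · λ|_{source})` as MEASURES on `U(σ_w H)(ℂ)`, and `∫ g dμ^TF_w = ∫_{𝔲} g(ĉ X) w₀(X) dλ(X)` ((U) road, U4-DISCHARGE, FILE 4;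
# Helgason 2000 Ch. I §1 Thm. 1.14 (13); Weyl 1939 Ch. II §10)

Topic `NumberTheory/Weil1964`, namespace `Literature.NumberTheory.Weil1964.UnitaryArchLocalTopForm`.  THEOREMS ONLY (no definition, no instance, no notation, no named fact,
no `sorry`).  Cell `pub/hodgecm-mathlib`, crux H413 = `stmt-HodgeConjecture-24833` (supports only).  Consumer: FILE 5 `UnitaryArchTopFormDiscConstant` ((W2)-(n2):
`π · C_disc(μ^TF on U(1,1)) = V₂`), and any evaluation of a top-form integral in the Cayley chart.
HONEST LABEL: HC_CM is proved only modulo the 2 remaining named inputs (hLiu418 24832, h413 24833) until rung 0 closes; nothing printed is discharged here.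

* §1 GENERIC over `Jw`: a left-invariant `μ` finite on compacta whose restriction to EVERY admissible chart image is the chart measure (`hwin`, restriction form, ★ (P0)'s shape) IS
  the chart measure of the whole source: `μ = cayleyChartMeasureC N Jw lam (cayleySourceC N Jw)` (★ FILE 1 `measure_compl_image_cayleySourceC_eq_zero` + ★ FILE 2
  `exhaustion_spec`, monotone unions on both sides); hence `∫⁻ g dμ = ∫⁻_{source} g(ĉ X) · w₀(X) dλ` and, for translation-invariant `lam` finite on compacta
  (`λ(sourceᶜ) = 0`, ★ FILE 1), `= ∫⁻_{𝔲(Jw)} g(ĉ X) · w₀(X) dλ`.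
* §2 CM reading at `Jw = σ_w H`, `H` `c`-hermitian with unit determinant: `archLocalTopFormHaar_eq_cayleyChartMeasureC`, `lintegral_archLocalTopFormHaar_eq_setLIntegral`,
  `lintegral_archLocalTopFormHaar_eq_lintegral` (★ FILE 3 `archLocalTopFormHaar_restrict_image_of_isOpen` discharges `hwin`).

## References
* S. Helgason, *Groups and Geometric Analysis*, AMS Math. Surveys Monogr. 83 (2000), Ch. I §1 Thm. 1.14 (13) p. 96. [Helgason2000]
* H. Weyl, *The Classical Groups, their Invariants and Representations*, Princeton (1939), Ch. II §10. [Weyl1939]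
* J. D. Rogawski, *Automorphic Representations of Unitary Groups in Three Variables*, Ann. of Math. Stud. 123 (1990), §1.7 p. 6. [Rogawski1990]
-/

set_option autoImplicit false
-- submodule-normed vs subtype topologies on `↥(skewC …)` (as in ★ U1 FILE B ∕ FILES 1–3)
set_option backward.isDefEq.respectTransparency false

noncomputable section

open Set Filter Topology MeasureTheory MeasureTheory.Measure NumberField NumberField.InfinitePlace Literature.Analysis.Calculus
open scoped Classical Matrix Matrix.Norms.Operator MatrixGroups ENNReal NNReal

namespace Literature.NumberTheory.Weil1964

namespace UnitaryArchLocalTopForm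

open Literature.NumberTheory.Automorphic Literature.NumberTheory.Automorphic.UnitaryGroup

/-! ## §1 Generic: the measure identity from the restriction-form any-window identity -/

section Generic

variable {N : ℕ} {Jw : Matrix (Fin N) (Fin N) ℂ}
variable [MeasurableSpace (skewC N Jw)] [BorelSpace (skewC N Jw)] [MeasurableSpace (GL (Fin N) ℂ)] [BorelSpace (GL (Fin N) ℂ)]

/-- **`μ = ĉ_*(w₀ · λ|_{source})`**: a left-invariant measure finite on compacta on `U(Jw)(ℂ)` whose restriction to every admissible chart image `ĉ(V)` is the chart measure
`ĉ_*(w₀ · λ|_V)` IS the chart measure of the whole source (null complement ★ FILE 1 + exhaustion ★ FILE 2). [cite: Helgason2000, Ch. I §1 Thm. 1.14 (13) p. 96] [cite: Weyl1939, Ch. II §10] -/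
theorem eq_cayleyChartMeasureC_cayleySourceC_of_window (μ : Measure (unitaryGroupOfForm (starRingEnd ℂ) Jw)) [IsFiniteMeasureOnCompacts μ] [μ.IsMulLeftInvariant]
    (lam : Measure (skewC N Jw))
    (hwin : ∀ V K : Set (skewC N Jw), IsOpen V → (0 : skewC N Jw) ∈ V → IsCompact K → K ⊆ cayleySourceC N Jw → V ⊆ K →
      μ.restrict (cayleyChartC N Jw '' V) = cayleyChartMeasureC N Jw lam V) :
    μ = cayleyChartMeasureC N Jw lam (cayleySourceC N Jw) := by
  obtain ⟨V, K, hVo, hV0, hKc, hKs, hVK, hmono, hU⟩ := exhaustion_spec N Jw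
  have hTo : IsOpen (cayleyChartC N Jw '' cayleySourceC N Jw) := isOpen_image_cayleyChartC subset_rfl isOpen_cayleySourceC
  refine Measure.ext fun S hS => ?_
  -- off the chart image `μ` vanishes
  have h1 : μ S = μ (S ∩ cayleyChartC N Jw '' cayleySourceC N Jw) := by
    rw [← measure_inter_add_sdiff S hTo.measurableSet,
      measure_mono_null (Set.sdiff_subset_compl _ _) (measure_compl_image_cayleySourceC_eq_zero μ), add_zero]
  -- both sides along the admissible exhaustion
  have h2 : S ∩ cayleyChartC N Jw '' cayleySourceC N Jw = ⋃ n, S ∩ cayleyChartC N Jw '' V n := by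
    rw [← hU, Set.image_iUnion, Set.inter_iUnion]
  have h3 : Monotone fun n => S ∩ cayleyChartC N Jw '' V n := fun n m hnm => Set.inter_subset_inter_right _ (Set.image_mono (hmono hnm))
  have h4 : Monotone fun n => cayleyChartC N Jw ⁻¹' S ∩ V n := fun n m hnm => Set.inter_subset_inter_right _ (hmono hnm)
  have h5 : cayleyChartC N Jw ⁻¹' S ∩ cayleySourceC N Jw = ⋃ n, cayleyChartC N Jw ⁻¹' S ∩ V n := by rw [← hU, Set.inter_iUnion]
  rw [h1, h2, h3.measure_iUnion, cayleyChartMeasureC_apply lam _ hS,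
    ← withDensity_apply _ ((measurable_cayleyChartC hS).inter isOpen_cayleySourceC.measurableSet), h5, h4.measure_iUnion]
  refine iSup_congr fun n => ?_
  rw [← Measure.restrict_apply hS, hwin (V n) (K n) (hVo n) (hV0 n) (hKc n) (hKs n) (hVK n), cayleyChartMeasureC_apply lam _ hS,
    withDensity_apply _ ((measurable_cayleyChartC hS).inter (hVo n).measurableSet)]

/-- **INTEGRATION IN THE CAYLEY CHART**: under the same hypotheses, `∫⁻ g dμ = ∫⁻_{source} g(ĉ X) · w₀(X) dλ` for every measurable `g ≥ 0`.
[cite: Helgason2000, Ch. I §1 Thm. 1.14 (13) p. 96] -/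
theorem lintegral_eq_setLIntegral_cayleyChartC_of_window (μ : Measure (unitaryGroupOfForm (starRingEnd ℂ) Jw)) [IsFiniteMeasureOnCompacts μ] [μ.IsMulLeftInvariant]
    (lam : Measure (skewC N Jw))
    (hwin : ∀ V K : Set (skewC N Jw), IsOpen V → (0 : skewC N Jw) ∈ V → IsCompact K → K ⊆ cayleySourceC N Jw → V ⊆ K →
      μ.restrict (cayleyChartC N Jw '' V) = cayleyChartMeasureC N Jw lam V)
    {g : unitaryGroupOfForm (starRingEnd ℂ) Jw → ℝ≥0∞} (hg : Measurable g) :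
    ∫⁻ h, g h ∂μ = ∫⁻ X in cayleySourceC N Jw, g (cayleyChartC N Jw X) * ENNReal.ofReal (cayleyWeightC N Jw X) ∂lam := by
  have hμ := eq_cayleyChartMeasureC_cayleySourceC_of_window μ lam hwin
  calc ∫⁻ h, g h ∂μ = ∫⁻ h, g h ∂(cayleyChartMeasureC N Jw lam (cayleySourceC N Jw)) := by rw [← hμ]
    _ = ∫⁻ X, g (cayleyChartC N Jw X) ∂((lam.restrict (cayleySourceC N Jw)).withDensity fun X => ENNReal.ofReal (cayleyWeightC N Jw X)) := by
        rw [cayleyChartMeasureC, lintegral_map hg measurable_cayleyChartC]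
    _ = ∫⁻ X in cayleySourceC N Jw, g (cayleyChartC N Jw X) * ENNReal.ofReal (cayleyWeightC N Jw X) ∂lam := by
        have h := lintegral_withDensity_eq_lintegral_mul (lam.restrict (cayleySourceC N Jw)) measurable_cayleyWeightC.ennreal_ofReal (hg.comp measurable_cayleyChartC)
        simp only [Pi.mul_apply, Function.comp_apply] at h
        rw [h]
        exact lintegral_congr fun X => mul_comm _ _

/-- The same over all of `𝔲(Jw)` when `lam` is translation-invariant and finite on compacta (`λ(sourceᶜ) = 0`, ★ FILE 1). [cite: Helgason2000, Ch. I §1 Thm. 1.14 (13) p. 96] -/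
theorem lintegral_eq_lintegral_cayleyChartC_of_window (μ : Measure (unitaryGroupOfForm (starRingEnd ℂ) Jw)) [IsFiniteMeasureOnCompacts μ] [μ.IsMulLeftInvariant]
    (lam : Measure (skewC N Jw)) [IsFiniteMeasureOnCompacts lam] [lam.IsAddLeftInvariant]
    (hwin : ∀ V K : Set (skewC N Jw), IsOpen V → (0 : skewC N Jw) ∈ V → IsCompact K → K ⊆ cayleySourceC N Jw → V ⊆ K →
      μ.restrict (cayleyChartC N Jw '' V) = cayleyChartMeasureC N Jw lam V)
    {g : unitaryGroupOfForm (starRingEnd ℂ) Jw → ℝ≥0∞} (hg : Measurable g) :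
    ∫⁻ h, g h ∂μ = ∫⁻ X, g (cayleyChartC N Jw X) * ENNReal.ofReal (cayleyWeightC N Jw X) ∂lam := by
  rw [lintegral_eq_setLIntegral_cayleyChartC_of_window μ lam hwin hg, setLIntegral_cayleySourceC_eq lam]

end Generic

/-! ## §2 The CM reading -/

section CM

variable (L : Type) [Field L] [NumberField L] [IsCMField L] (N : ℕ) (H : Matrix (Fin N) (Fin N) L)

/-- **`μ^TF_w = ĉ_{w*}(w₀,w · λ_w|_{source})` AS MEASURES** on `U(σ_w H)(ℂ)`, for `H` `c`-hermitian with unit determinant over the CM field `L` (★ FILE 3's any-window identity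
fed to §1). [cite: Helgason2000, Ch. I §1 Thm. 1.14 (13) p. 96] [cite: Rogawski1990, §1.7 p. 6] -/
theorem archLocalTopFormHaar_eq_cayleyChartMeasureC (hherm : (H.map (IsCMField.complexConj L))ᵀ = H) (hdet : IsUnit H.det)
    (w : {w : InfinitePlace L // IsComplex w}) [MeasurableSpace (GL (Fin N) ℂ)] [BorelSpace (GL (Fin N) ℂ)]
    [MeasurableSpace ↥(skewC N (H.map w.1.embedding))] [BorelSpace ↥(skewC N (H.map w.1.embedding))] :
    archLocalTopFormHaar L N H w =
      cayleyChartMeasureC N (H.map w.1.embedding) (lieStdLebesgueC N (H.map w.1.embedding)) (cayleySourceC N (H.map w.1.embedding)) := by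
  have hnd := lieGramDetC_map_embedding_ne_zero L N H hherm hdet w
  haveI : LocallyCompactSpace ↥(unitaryGroupOfForm (starRingEnd ℂ) (H.map w.1.embedding)) := locallyCompactSpace_unitaryGroupOfForm_complex (n := Fin N) _
  haveI : SecondCountableTopology ↥(unitaryGroupOfForm (starRingEnd ℂ) (H.map w.1.embedding)) := secondCountableTopology_unitaryGroupOfForm_complex (n := Fin N) _
  haveI : (localTopFormHaar N (H.map w.1.embedding)).IsHaarMeasure := isHaarMeasure_localTopFormHaar hnd
  exact eq_cayleyChartMeasureC_cayleySourceC_of_window (localTopFormHaar N (H.map w.1.embedding)) (lieStdLebesgueC N (H.map w.1.embedding))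
    fun V K hVo h0 hK hKs hVK => archLocalTopFormHaar_restrict_image_of_isOpen L N H hherm hdet w hVo h0 hK hKs hVK

/-- **INTEGRATION AGAINST `μ^TF_w` IN THE CAYLEY CHART (source form)**: `∫⁻ g dμ^TF_w = ∫⁻_{source} g(ĉ_w X) · w₀,w(X) dλ_w` for measurable `g ≥ 0`.
[cite: Helgason2000, Ch. I §1 Thm. 1.14 (13) p. 96] [cite: Rogawski1990, §1.7 p. 6] -/
theorem lintegral_archLocalTopFormHaar_eq_setLIntegral (hherm : (H.map (IsCMField.complexConj L))ᵀ = H) (hdet : IsUnit H.det)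
    (w : {w : InfinitePlace L // IsComplex w}) [MeasurableSpace (GL (Fin N) ℂ)] [BorelSpace (GL (Fin N) ℂ)]
    [MeasurableSpace ↥(skewC N (H.map w.1.embedding))] [BorelSpace ↥(skewC N (H.map w.1.embedding))]
    {g : archLocal L N H w → ℝ≥0∞} (hg : Measurable g) :
    ∫⁻ h, g h ∂archLocalTopFormHaar L N H w =
      ∫⁻ X in cayleySourceC N (H.map w.1.embedding), g (cayleyChartC N (H.map w.1.embedding) X) * ENNReal.ofReal (cayleyWeightC N (H.map w.1.embedding) X)
        ∂lieStdLebesgueC N (H.map w.1.embedding) := by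
  have hnd := lieGramDetC_map_embedding_ne_zero L N H hherm hdet w
  haveI : LocallyCompactSpace ↥(unitaryGroupOfForm (starRingEnd ℂ) (H.map w.1.embedding)) := locallyCompactSpace_unitaryGroupOfForm_complex (n := Fin N) _
  haveI : SecondCountableTopology ↥(unitaryGroupOfForm (starRingEnd ℂ) (H.map w.1.embedding)) := secondCountableTopology_unitaryGroupOfForm_complex (n := Fin N) _
  haveI : (localTopFormHaar N (H.map w.1.embedding)).IsHaarMeasure := isHaarMeasure_localTopFormHaar hnd
  exact lintegral_eq_setLIntegral_cayleyChartC_of_window (localTopFormHaar N (H.map w.1.embedding)) (lieStdLebesgueC N (H.map w.1.embedding))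
    (fun V K hVo h0 hK hKs hVK => archLocalTopFormHaar_restrict_image_of_isOpen L N H hherm hdet w hVo h0 hK hKs hVK) hg

/-- **INTEGRATION AGAINST `μ^TF_w` IN THE CAYLEY CHART (whole Lie algebra)**: `∫⁻ g dμ^TF_w = ∫⁻_{𝔲(σ_w H)} g(ĉ_w X) · w₀,w(X) dλ_w` for measurable `g ≥ 0`.
[cite: Helgason2000, Ch. I §1 Thm. 1.14 (13) p. 96] [cite: Rogawski1990, §1.7 p. 6] -/
theorem lintegral_archLocalTopFormHaar_eq_lintegral (hherm : (H.map (IsCMField.complexConj L))ᵀ = H) (hdet : IsUnit H.det)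
    (w : {w : InfinitePlace L // IsComplex w}) [MeasurableSpace (GL (Fin N) ℂ)] [BorelSpace (GL (Fin N) ℂ)]
    [MeasurableSpace ↥(skewC N (H.map w.1.embedding))] [BorelSpace ↥(skewC N (H.map w.1.embedding))]
    {g : archLocal L N H w → ℝ≥0∞} (hg : Measurable g) :
    ∫⁻ h, g h ∂archLocalTopFormHaar L N H w =
      ∫⁻ X, g (cayleyChartC N (H.map w.1.embedding) X) * ENNReal.ofReal (cayleyWeightC N (H.map w.1.embedding) X) ∂lieStdLebesgueC N (H.map w.1.embedding) := by
  have hnd := lieGramDetC_map_embedding_ne_zero L N H hherm hdet w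
  haveI := isAddHaarMeasure_lieStdLebesgueC (N := N) (Jw := H.map w.1.embedding) hnd
  rw [lintegral_archLocalTopFormHaar_eq_setLIntegral L N H hherm hdet w hg, setLIntegral_cayleySourceC_eq]

end CM

end UnitaryArchLocalTopForm

end Literature.NumberTheory.Weil1964

end
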